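import Summits.BirchSwinnertonDyer.BirchSwinnertonDyer.Theorems.SignedLowerHalvesSmallImageLowerHalfBothSignsRttD2SeqJ3LocalLevelChange
import Summits.BirchSwinnertonDyer.BirchSwinnertonDyer.Theorems.SignedLowerHalvesSmallImageLowerHalfBothSignsRttD2SeqJ3LayerPairing
import Literature.NumberTheory.EllipticCurves.Kato2004.LocalIwasawaCohomology
import Literature.NumberTheory.GaloisRepresentations.BrauerTower
import Literature.NumberTheory.EllipticCurves.AnticyclotomicSignedLocalConditions
import Literature.NumberTheory.ComplexMultiplication.EllipticUnits.ImaginaryQuadraticMainConjectureCarriersCores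
import HarnessLib

/-!
# Route `SignedLowerHalves`, crux L `SmallImageLowerHalfBothSigns` (stmt-BirchSwinnertonDyer-23599), line `rtt_w3` v14 → v15 — E2, row J3
# (Galois side, part β₃b): THE LOCALISATION `loc_{n,v} : H¹(G_P(K_n), X_k) → H¹(U_{n,v}, X_k)` OF honda's LAYER GROUPS AT THE CHOSEN PLACE `v`, AND ITS FOUR COMPATIBILITIES
# (`cor ↦ cor` by the one-coset Mackey formula — `v` non-split in `K_∞` —, coefficient maps, and `conj_{γ_B} ↦ conj_{γ_v⁻¹}` under `γ_B·res(γ_v) ∈ ker κ`)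

WIDTH seat `bsd-line-slh-p3-w3` g22 under LEAD `cruxlead-stmt-BirchSwinnertonDyer-23599` g11 (cell `bsd-ssimc`); helper `--supports stmt-BirchSwinnertonDyer-23599`.
DEFINITIONS WITH BODIES + THEOREMS; no named fact, no instance, no `sorry`. HONEST FRAMING: the GLOBAL→LOCAL half of the inhabitant of `LayerPairing` (p784142): composed with the
local pairings `pairLoc` of part β₃a (p786363, p787141) it gives `pairNK n k := pairLoc n k ∘ loc_{n,v}` with its four laws (sequel, β₃c). E2, crux L, crux M, BSD remain OPEN
and are proved for NO curve.

* §1 `locGS P v : Γ_{K_v} → G_P` (`π ∘ res_v`), `locCoeffRep S θ′ P v k` (honda's coefficients `X_k = (𝒪 ⊗ μ_{p^k} ⊗ θ′)^{N_P}` restricted to `Γ_{K_v}`), `locLayerHom κ P v n :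
  U_{n,v} → (U_n)_P` (`U_{n,v} = res_v⁻¹ U_n`, `U_n = Gal(K̄/K_n)`), `locLayerMod` (identity on vectors), ★ `locNK n k : cycLayerCohO S κ θ′ P n k 1 →+ H¹(U_{n,v}, X_k)`.
* §2 Inputs of the Mackey formula: `locLayerHom_mem_iff` (`θ⁻¹((U_{n+1})_P) = U_{n+1,v}`, uses `N_P ≤ U_{n+1}` = `κ` unramified outside `P`), `exists_locLayerHom_coset`
  (`U_{n,v}` meets every coset of `(U_{n+1})_P` in `(U_n)_P` — `v` NON-SPLIT in `K_∞`, `AcSigned.IsNonsplitIn κ v`), `relCoresO_one_eq_coresLe` (honda's trace IS the tree's `coresLe`).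
* §3 LAWS: ★★ `locNK_cycLayerCoresO` (`loc ∘ cor_{K_{n+1}/K_n} = cor_{U_{n+1,v}/U_{n,v}} ∘ loc`, Kato2004's `map_coresLe_eq_coresLe_map`); ★ `locNK_levelMapHomO` (`loc ∘ H¹(f) = H¹(f|) ∘ loc`
  for every equivariant coefficient map — reduction and `𝒪`-scalars: `locNK_cycLayerRedO`, `locNK_cycLayerScalarO`); ★★ `locNK_cycLayerConjO` (`loc ∘ conj_{γ_B} = conj_{γ_v⁻¹} ∘ loc`
  when `γ_B · res_v(γ_v) ∈ ker κ` — RULING (F2)).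
References: [NeukirchSchmidtWingberg2008] I §5 Prop. 1.5.3–1.5.4, (1.5.6)–(1.5.7); [Kato2004Asterisque] §17.13; [Rubin2000] App. B.2; [SerreGaloisCohomology1997] I §2.4–2.5.
-/

set_option autoImplicit false
set_option linter.dupNamespace false -- D-0017: single-problem summit, the namespace repeats the problem name by design
noncomputable section

open scoped Classical
open NumberField IsDedekindDomain Field CategoryTheory Function

namespace Summit.BirchSwinnertonDyer.BirchSwinnertonDyer.Theorems.SmallImageRttD2Seq

open Literature.NumberTheory.EllipticCurves Literature.NumberTheory.GaloisRepresentations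
  Literature.NumberTheory.ComplexMultiplication.EllipticUnits.JohnsonLeungKings2011
  Literature.NumberTheory.EllipticCurves.Kato2004
  Summit.BirchSwinnertonDyer.BirchSwinnertonDyer.Theorems.SmallImageRttD2J1

section Loc

variable {K : Type} [Field K] [NumberField K] {p : ℕ} [Fact p.Prime] (S : Set (PadicAlgCl p)) (κ : ZpExtension K p)
  (θ' : absoluteGaloisGroup K →ₜ* (padicCoeffIntegers S)ˣ) (P : Set (HeightOneSpectrum (𝓞 K))) (v : HeightOneSpectrum (𝓞 K))

/-! ## §1. The localisation maps -/

/-- **`Γ_{K_v} → G_P = Gal(K_P/K)`**: the projection after the restriction `res_v` of the chosen embedding `K̄ ↪ K̄_v`. [cite: NeukirchSchmidtWingberg2008, (8.3.*) / I §5] -/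
def locGS : absoluteGaloisGroup (v.adicCompletion K) →ₜ* GaloisGroupUnramifiedOutside K P :=
  (toUnramifiedQuotCont K P).comp (resGalOfEmb (closureEmb (K := K) (v.adicCompletion K)))

/-- Unfolding `locGS`. [folklore] -/
theorem locGS_apply (τ : absoluteGaloisGroup (v.adicCompletion K)) :
    locGS P v τ = toUnramifiedQuot K P (resGalOfEmb (closureEmb (K := K) (v.adicCompletion K)) τ) :=
  rfl

/-- **honda's coefficients `X_k = (𝒪 ⊗ μ_{p^k} ⊗ θ′)^{N_P}` as a representation of `Γ_{K_v}`** (through `locGS`). [cite: JohnsonLeungKings2011, Def. 4.2] [cite: Kato2004Asterisque, §17.13] -/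
def locCoeffRep (k : ℕ) :
    ContinuousRep (absoluteGaloisGroup (v.adicCompletion K)) ℤ
      ↥(Representation.invariants ((muTwistO S θ' k).toRepresentation.comp (ramificationSubgroup K P).subtype)) :=
  (coeffGSO S P θ' k).restrict (locGS P v)

/-- Unfolding `locCoeffRep`: `τ` acts as `π(res_v τ)`. [folklore] -/
theorem locCoeffRep_apply (k : ℕ) (τ : absoluteGaloisGroup (v.adicCompletion K)) :
    locCoeffRep S θ' P v k τ = coeffGSO S P θ' k (locGS P v τ) :=
  rfl

/-- **`U_{n,v} → (U_n)_P`**: `locGS` restricted to `U_{n,v} = res_v⁻¹(U_n)`, `U_n = Gal(K̄/K_n)`, corestricted to the image `(U_n)_P` of `U_n` in `G_P`. [cite: NeukirchSchmidtWingberg2008, I §5] -/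
def locLayerHom (n : ℕ) :
    ↥(localSubgroupOfEmb (κ.layerSubgroup n) (closureEmb (K := K) (v.adicCompletion K))) →ₜ* ↥(imGS P (κ.layerSubgroup n)) where
  toFun τ := ⟨locGS P v τ, Subgroup.mem_map_of_mem _ ((mem_localSubgroupOfEmb_iff _ _ _).mp τ.2)⟩
  map_one' := Subtype.ext (map_one _)
  map_mul' a b := Subtype.ext (map_mul _ _ _)
  continuous_toFun := by
    apply Continuous.subtype_mk
    exact (locGS P v).continuous.comp continuous_subtype_val

/-- Unfolding `locLayerHom`. [folklore] -/
theorem locLayerHom_apply_coe (n : ℕ) (τ : ↥(localSubgroupOfEmb (κ.layerSubgroup n) (closureEmb (K := K) (v.adicCompletion K)))) :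
    ((locLayerHom κ P v n τ : ↥(imGS P (κ.layerSubgroup n))) : GaloisGroupUnramifiedOutside K P) = locGS P v τ :=
  rfl

/-- The coefficient morphism over `locLayerHom`: the identity on vectors of `X_k` (the tree's `subgroupRep` vocabulary on both sides, as in Kato2004's `layerLocRepHom`). [folklore] -/
def locLayerMod (n k : ℕ) :
    TopRep.res (locLayerHom κ P v n : _ →* _) (subgroupRep (coeffGSO S P θ' k).toTopRep (imGS P (κ.layerSubgroup n))) ⟶
      subgroupRep (locCoeffRep S θ' P v k).toTopRep (localSubgroupOfEmb (κ.layerSubgroup n) (closureEmb (K := K) (v.adicCompletion K))) :=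
  TopRep.ofHom ⟨ContinuousLinearMap.id ℤ _, fun _ ↦ rfl⟩

/-- ★ **The localisation `loc_{n,v} : H¹(G_P(K_n), X_k) → H¹(U_{n,v}, X_k)`** of honda's layer groups at the chosen place: the cohomology map of the pair (`locLayerHom`, identity)
(honda's `levelCohO_eq`: the layer group IS `H¹` of `subgroupRep X_k (U_n)_P`). [cite: NeukirchSchmidtWingberg2008, I §5] [cite: Kato2004Asterisque, §17.13 (17.13.1)] -/
def locNK (n k : ℕ) :
    cycLayerCohO S κ θ' P n k 1 →+
      (continuousCohomology 1 (subgroupRep (locCoeffRep S θ' P v k).toTopRep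
        (localSubgroupOfEmb (κ.layerSubgroup n) (closureEmb (K := K) (v.adicCompletion K)))) : Type) :=
  (ContinuousCohomology.map (locLayerHom κ P v n) (locLayerMod S κ θ' P v n k) 1).hom.toLinearMap.toAddMonoidHom

/-- The coefficient morphism of `loc_{n,v}` is the identity on vectors (stated once, so that its uses are kernel-cheap — cf. Kato2004's `layerLocRepHom_hom_apply`). [folklore] -/
theorem locLayerMod_hom_apply (n k : ℕ) (m : ↥(Representation.invariants ((muTwistO S θ' k).toRepresentation.comp (ramificationSubgroup K P).subtype))) :
    (locLayerMod S κ θ' P v n k).hom m = m :=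
  rfl

/-- `locLayerHom (n+1)` and `locLayerHom n` agree in `G_P` on `U_{n+1,v} ≤ U_{n,v}`. [folklore] -/
theorem locLayerHom_succ_coe (n : ℕ) (x : ↥(localSubgroupOfEmb (κ.layerSubgroup (n + 1)) (closureEmb (K := K) (v.adicCompletion K)))) :
    ((locLayerHom κ P v (n + 1) x : ↥(imGS P (κ.layerSubgroup (n + 1)))) : GaloisGroupUnramifiedOutside K P) =
      ((locLayerHom κ P v n ⟨x, localSubgroupOfEmb_layerSubgroup_antitone κ v (Nat.le_succ n) x.2⟩ : ↥(imGS P (κ.layerSubgroup n))) :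
        GaloisGroupUnramifiedOutside K P) := by
  rw [locLayerHom_apply_coe, locLayerHom_apply_coe]

/-- Unfolding `locNK`. [folklore] -/
theorem locNK_apply (n k : ℕ) (y : cycLayerCohO S κ θ' P n k 1) :
    locNK S κ θ' P v n k y = ContinuousCohomology.map (locLayerHom κ P v n) (locLayerMod S κ θ' P v n k) 1 y :=
  rfl

/-! ## §2. Inputs of the one-coset Mackey formula -/

/-- `θ⁻¹((U_{n+1})_P) ∩ U_{n,v} = U_{n+1,v}` when `N_P ≤ U_{n+1}` (`K_∞/K` unramified outside `P`). [cite: NeukirchSchmidtWingberg2008, I §5 (1.5.6)] -/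
theorem locLayerHom_mem_iff (hNP : ∀ n, ramificationSubgroup K P ≤ κ.layerSubgroup n) (n : ℕ)
    (x : ↥(localSubgroupOfEmb (κ.layerSubgroup n) (closureEmb (K := K) (v.adicCompletion K)))) :
    ((locLayerHom κ P v n x : ↥(imGS P (κ.layerSubgroup n))) : GaloisGroupUnramifiedOutside K P) ∈ imGS P (κ.layerSubgroup (n + 1)) ↔
      (x : absoluteGaloisGroup (v.adicCompletion K)) ∈ localSubgroupOfEmb (κ.layerSubgroup (n + 1)) (closureEmb (K := K) (v.adicCompletion K)) := by
  rw [locLayerHom_apply_coe, locGS_apply, mem_localSubgroupOfEmb_iff]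
  constructor
  · rintro ⟨u, hu, he⟩
    obtain ⟨z, hz, hz'⟩ := (QuotientGroup.mk'_eq_mk' _).mp he
    rw [← hz']
    exact Subgroup.mul_mem _ hu (hNP (n + 1) hz)
  · exact fun h ↦ Subgroup.mem_map_of_mem _ h

/-- `U_{n,v}` meets every coset of `(U_{n+1})_P` in `(U_n)_P` when `v` is non-split in `K_∞` (`κ ∘ res_v` onto). [cite: NeukirchSchmidtWingberg2008, I §5 (1.5.7)] [cite: Kato2004Asterisque, §17.13] -/
theorem exists_locLayerHom_coset (hv : AcSigned.IsNonsplitIn κ v) (n : ℕ) (g : ↥(imGS P (κ.layerSubgroup n))) :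
    ∃ g' : ↥(localSubgroupOfEmb (κ.layerSubgroup n) (closureEmb (K := K) (v.adicCompletion K))),
      (locLayerHom κ P v n g')⁻¹ * g ∈ (imGS P (κ.layerSubgroup (n + 1))).subgroupOf (imGS P (κ.layerSubgroup n)) := by
  obtain ⟨g, u, hu, rfl⟩ := g
  obtain ⟨τ, hτ⟩ := hv (κ u)
  have hτ' : κ (resGalOfEmb (closureEmb (K := K) (v.adicCompletion K)) τ) = κ u := hτ
  have hmem : τ ∈ localSubgroupOfEmb (κ.layerSubgroup n) (closureEmb (K := K) (v.adicCompletion K)) := by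
    rw [mem_localSubgroupOfEmb_iff, ZpExtension.mem_layerSubgroup]
    rw [hτ']
    exact ZpExtension.mem_layerSubgroup.mp hu
  refine ⟨⟨τ, hmem⟩, ?_⟩
  rw [Subgroup.mem_subgroupOf, Subgroup.coe_mul, Subgroup.coe_inv, locLayerHom_apply_coe, locGS_apply, ← map_inv, ← map_mul]
  refine Subgroup.mem_map_of_mem _ (κ.kerSubgroup_le_layerSubgroup (n + 1) ?_)
  rw [ZpExtension.mem_kerSubgroup, map_mul, map_inv, hτ', inv_mul_cancel]

omit [NumberField K] in
/-- The image in `G_P` of an open subgroup has finite index (`G_P` is compact). [folklore] -/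
theorem finiteIndex_imGS_of_isOpen {U : Subgroup (absoluteGaloisGroup K)} (hU : IsOpen (U : Set (absoluteGaloisGroup K))) :
    (imGS P U).FiniteIndex := by
  haveI : CompactSpace (absoluteGaloisGroup K) := absoluteGaloisGroup_compactSpace K
  haveI : CompactSpace (GaloisGroupUnramifiedOutside K P) := Quotient.compactSpace
  haveI : DiscreteTopology (GaloisGroupUnramifiedOutside K P ⧸ imGS P U) := QuotientGroup.discreteTopology (isOpen_imGS_of_isOpen P hU)
  haveI : Finite (GaloisGroupUnramifiedOutside K P ⧸ imGS P U) := finite_of_compact_of_discrete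
  exact Subgroup.finiteIndex_of_finite_quotient

omit [NumberField K] in
/-- The relative quotient `(U)_P / (U′)_P` is finite for `U′` open. [folklore] -/
theorem finite_imGS_quot {U U' : Subgroup (absoluteGaloisGroup K)} (hU' : IsOpen (U' : Set (absoluteGaloisGroup K))) :
    Finite (↥(imGS P U) ⧸ (imGS P U').subgroupOf (imGS P U)) := by
  haveI := finiteIndex_imGS_of_isOpen P hU'
  exact Subgroup.finite_quotient_of_finiteIndex

/-- **honda's trace `relCoresO` in degree 1 IS the tree's `coresLe`** on the ambient `G_P`-module `X_k` (`cores = cor` in degree 1, `cores_eq_cor`). [cite: SerreGaloisCohomology1997, I §2.5] -/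
theorem relCoresO_one_eq_coresLe {U U' : Subgroup (absoluteGaloisGroup K)} (h : U' ≤ U) (hU : IsOpen (U : Set (absoluteGaloisGroup K)))
    (hU' : IsOpen (U' : Set (absoluteGaloisGroup K))) (k : ℕ) [inst : Fintype (↥(imGS P U) ⧸ (imGS P U').subgroupOf (imGS P U))] (y : levelCohO S P θ' U' k 1) :
    relCoresO S P θ' h hU hU' k 1 y = coresLe (coeffGSO S P θ' k).toTopRep (imGS_le_of_le P h) (isOpen_imGS_of_isOpen P hU') y := by
  haveI := finite_imGS_quot P (U := U) hU'
  obtain rfl : inst = Fintype.ofFinite _ := Subsingleton.elim _ _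
  haveI : TotallyDisconnectedSpace (GaloisGroupUnramifiedOutside K P) :=
    Literature.GroupTheory.ProfiniteSubquotients.totallyDisconnectedSpace_quotient (ramificationSubgroup K P) (ramificationSubgroup_isClosed K P)
  haveI : CompactSpace (imGS P U) :=
    isCompact_iff_compactSpace.mp (Subgroup.isClosed_of_isOpen _ (isOpen_imGS_of_isOpen P hU)).isCompact
  haveI : IsClosed (((imGS P U').subgroupOf (imGS P U) : Subgroup (imGS P U)) : Set (imGS P U)) :=
    (Subgroup.isClosed_of_isOpen _ (isOpen_imGS_of_isOpen P hU')).preimage continuous_subtype_val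
  haveI := finiteIndex_imGS_of_isOpen P hU'
  letI : Fintype (↥(imGS P U) ⧸ (imGS P U').subgroupOf (imGS P U)) := Fintype.ofFinite _
  rw [coresLe, LinearMap.comp_apply]
  exact (cores_eq_cor (ρ := levelRepO S P θ' U k) (S := (imGS P U').subgroupOf (imGS P U))
    ((isOpen_imGS_of_isOpen P hU').preimage continuous_subtype_val) _).symm

/-! ## §3. The four compatibilities -/

section Laws

variable [hq : ∀ n : ℕ, Fintype (↥(localSubgroupOfEmb (κ.layerSubgroup n) (closureEmb (K := K) (v.adicCompletion K))) ⧸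
  (localSubgroupOfEmb (κ.layerSubgroup (n + 1)) (closureEmb (K := K) (v.adicCompletion K))).subgroupOf
    (localSubgroupOfEmb (κ.layerSubgroup n) (closureEmb (K := K) (v.adicCompletion K))))]

/-- **The one-coset Mackey formula for `U_{n+1,v} ≤ U_{n,v}` over `(U_{n+1})_P ≤ (U_n)_P`** in the tree's `coresLe` vocabulary (Kato2004's `map_coresLe_eq_coresLe_map`).
[cite: NeukirchSchmidtWingberg2008, I §5 Prop. 1.5.4, (1.5.6)–(1.5.7)] -/
theorem map_locLayer_coresLe (hNP : ∀ n, ramificationSubgroup K P ≤ κ.layerSubgroup n) (hv : AcSigned.IsNonsplitIn κ v) (n k : ℕ)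
    [Fintype (↥(imGS P (κ.layerSubgroup n)) ⧸ (imGS P (κ.layerSubgroup (n + 1))).subgroupOf (imGS P (κ.layerSubgroup n)))]
    (y : continuousCohomology 1 (subgroupRep (coeffGSO S P θ' k).toTopRep (imGS P (κ.layerSubgroup (n + 1))))) :
    ContinuousCohomology.map (locLayerHom κ P v n) (locLayerMod S κ θ' P v n k) 1
        (coresLe (coeffGSO S P θ' k).toTopRep (imGS_le_of_le P (κ.layerSubgroup_antitone (Nat.le_succ n)))
          (isOpen_imGS_of_isOpen P (κ.isOpen_layerSubgroup (n + 1))) y) =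
      coresLe (locCoeffRep S θ' P v k).toTopRep (localSubgroupOfEmb_layerSubgroup_antitone κ v (Nat.le_succ n))
        (isOpen_localSubgroupOfEmb_layerSubgroup κ v (n + 1)) (ContinuousCohomology.map (locLayerHom κ P v (n + 1)) (locLayerMod S κ θ' P v (n + 1) k) 1 y) :=
  map_coresLe_eq_coresLe_map (coeffGSO S P θ' k).toTopRep (locCoeffRep S θ' P v k).toTopRep
    (imGS_le_of_le P (κ.layerSubgroup_antitone (Nat.le_succ n))) (isOpen_imGS_of_isOpen P (κ.isOpen_layerSubgroup (n + 1)))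
    (localSubgroupOfEmb_layerSubgroup_antitone κ v (Nat.le_succ n)) (isOpen_localSubgroupOfEmb_layerSubgroup κ v (n + 1))
    (locLayerHom κ P v n) (locLayerHom κ P v (n + 1))
    (locLayerHom_succ_coe κ P v n) (locLayerHom_mem_iff κ P v hNP n) (exists_locLayerHom_coset κ P v hv n) (locLayerMod S κ θ' P v n k)
    (locLayerMod S κ θ' P v (n + 1) k) (fun m ↦ by rw [locLayerMod_hom_apply, locLayerMod_hom_apply]) y

/-- ★★ **`loc ∘ cor_{K_{n+1}/K_n} = cor_{U_{n+1,v}/U_{n,v}} ∘ loc`** — the one-coset Mackey formula at a place NON-SPLIT in `K_∞`.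
[cite: NeukirchSchmidtWingberg2008, I §5 Prop. 1.5.4, (1.5.6)–(1.5.7)] [cite: Kato2004Asterisque, §17.13] -/
theorem locNK_cycLayerCoresO (hNP : ∀ n, ramificationSubgroup K P ≤ κ.layerSubgroup n) (hv : AcSigned.IsNonsplitIn κ v) (n k : ℕ)
    (y : cycLayerCohO S κ θ' P (n + 1) k 1) :
    locNK S κ θ' P v n k (cycLayerCoresO S κ θ' P n k 1 y) =
      coresLe (locCoeffRep S θ' P v k).toTopRep (localSubgroupOfEmb_layerSubgroup_antitone κ v (Nat.le_succ n))
        (isOpen_localSubgroupOfEmb_layerSubgroup κ v (n + 1)) (locNK S κ θ' P v (n + 1) k y) := by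
  haveI := finite_imGS_quot P (U := κ.layerSubgroup n) (κ.isOpen_layerSubgroup (n + 1))
  letI : Fintype (↥(imGS P (κ.layerSubgroup n)) ⧸ (imGS P (κ.layerSubgroup (n + 1))).subgroupOf (imGS P (κ.layerSubgroup n))) := Fintype.ofFinite _
  rw [locNK_apply, locNK_apply, cycLayerCoresO,
    relCoresO_one_eq_coresLe S θ' P (κ.layerSubgroup_antitone (Nat.le_succ n)) (κ.isOpen_layerSubgroup n) (κ.isOpen_layerSubgroup (n + 1)) k y]
  exact map_locLayer_coresLe S κ θ' P v hNP hv n k y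

omit hq in
/-- ★ **`loc ∘ H¹(f) = H¹(f|) ∘ loc`** for an equivariant coefficient map `f : 𝒪 ⊗ μ_{p^k} ⊗ θ′ → 𝒪 ⊗ μ_{p^{k′}} ⊗ θ′` (honda's `levelMapHomO`; local side `redMapH1` of part β₃a).
[cite: NeukirchSchmidtWingberg2008, I §5 Prop. 1.5.2] -/
theorem locNK_levelMapHomO (n : ℕ) {k k' : ℕ} (f : OMuCarrier K S (p ^ k) →+ OMuCarrier K S (p ^ k'))
    (hf : ∀ (σ : absoluteGaloisGroup K) (x : OMuCarrier K S (p ^ k)), f (muTwistO S θ' k σ x) = muTwistO S θ' k' σ (f x)) (y : cycLayerCohO S κ θ' P n k 1) :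
    locNK S κ θ' P v n k' ((ContinuousCohomology.map (ContinuousMonoidHom.id _) (levelMapHomO S P θ' (κ.layerSubgroup n) f hf) 1).hom y) =
      redMapH1 v (locCoeffRep S θ' P v) _ (coeffMapO S P θ' f hf).toAddMonoidHom
        (fun g x ↦ congrArg (fun φ : _ →L[ℤ] _ ↦ φ x) ((coeffMapHomO S P θ' f hf).hom.isIntertwining' (locGS P v g)))
        (locNK S κ θ' P v n k y) := by
  rw [locNK_apply, locNK_apply, redMapH1_apply]
  have e1 := map_comp_apply_of (ContinuousMonoidHom.id _) (locLayerHom κ P v n) (locLayerHom κ P v n) (fun _ ↦ rfl)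
      (levelMapHomO S P θ' (κ.layerSubgroup n) f hf) (locLayerMod S κ θ' P v n k')
      (TopRep.ofHom ⟨⟨coeffMapO S P θ' f hf, continuous_of_discreteTopology⟩, fun g ↦ (levelMapHomO S P θ' (κ.layerSubgroup n) f hf).hom.isIntertwining'
        (locLayerHom κ P v n g)⟩) (fun _ ↦ rfl) 1 y
  have e2 := map_comp_apply_of (locLayerHom κ P v n) (ContinuousMonoidHom.id _) (locLayerHom κ P v n) (fun _ ↦ rfl)
      (locLayerMod S κ θ' P v n k) (redResHom v (locCoeffRep S θ' P v) _ (coeffMapO S P θ' f hf).toAddMonoidHom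
        (fun g x ↦ congrArg (fun φ : _ →L[ℤ] _ ↦ φ x) ((coeffMapHomO S P θ' f hf).hom.isIntertwining' (locGS P v g))))
      (TopRep.ofHom ⟨⟨coeffMapO S P θ' f hf, continuous_of_discreteTopology⟩, fun g ↦ (levelMapHomO S P θ' (κ.layerSubgroup n) f hf).hom.isIntertwining'
        (locLayerHom κ P v n g)⟩) (fun _ ↦ rfl) 1 y
  exact e1.symm.trans e2

omit hq in
/-- `loc ∘ red = H¹(red|) ∘ loc` (reduction of coefficients `μ_{p^{k+1}} → μ_{p^k}`). [cite: Kato2004Asterisque, §8.2] -/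
theorem locNK_cycLayerRedO (n k : ℕ) (y : cycLayerCohO S κ θ' P n (k + 1) 1) :
    locNK S κ θ' P v n k (cycLayerRedO S κ θ' P n k 1 y) =
      redMapH1 v (locCoeffRep S θ' P v) _ (coeffMapO S P θ' (oMuRed S k) (oMuRed_muTwistO S θ' k)).toAddMonoidHom
        (fun g x ↦ congrArg (fun φ : _ →L[ℤ] _ ↦ φ x) ((coeffMapHomO S P θ' (oMuRed S k) (oMuRed_muTwistO S θ' k)).hom.isIntertwining' (locGS P v g)))
        (locNK S κ θ' P v n (k + 1) y) :=
  locNK_levelMapHomO S κ θ' P v n (oMuRed S k) (oMuRed_muTwistO S θ' k) y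

omit hq in
/-- `loc ∘ H¹(c ⊗ id) = H¹((c ⊗ id)|) ∘ loc` (the `𝒪`-scalars). [cite: JohnsonLeungKings2011, §4.1 Def. 4.1] -/
theorem locNK_cycLayerScalarO (n k : ℕ) (c : padicCoeffIntegers S) (y : cycLayerCohO S κ θ' P n k 1) :
    locNK S κ θ' P v n k (cycLayerScalarO S κ θ' P n k 1 c y) =
      redMapH1 v (locCoeffRep S θ' P v) _ (coeffMapO S P θ' (oMuScalar S (p ^ k) c) (oMuScalar_muTwistO S θ' k c)).toAddMonoidHom
        (fun g x ↦ congrArg (fun φ : _ →L[ℤ] _ ↦ φ x) ((coeffMapHomO S P θ' (oMuScalar S (p ^ k) c) (oMuScalar_muTwistO S θ' k c)).hom.isIntertwining' (locGS P v g)))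
        (locNK S κ θ' P v n k y) :=
  locNK_levelMapHomO S κ θ' P v n (oMuScalar S (p ^ k) c) (oMuScalar_muTwistO S θ' k c) y

omit hq in
/-- ★★ **`loc ∘ conj_{γ_B} = conj_{γ_v⁻¹} ∘ loc` when `γ_B · res_v(γ_v) ∈ ker κ`** (RULING (F2): the Galois-side generator is pinned at `κ = −κ(res γ_v)`): `π(γ_B) ≡ π(res_v γ_v⁻¹)`
modulo `(U_n)_P` (which acts trivially on `H¹((U_n)_P, ·)`), and restriction along `U_{n,v} → (U_n)_P` intertwines `conj_{π res γ}` with `conj_γ`.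
[cite: NeukirchSchmidtWingberg2008, I §5 Prop. 1.5.3 (iii)] [cite: Kato2004Asterisque, §17.13] -/
theorem locNK_cycLayerConjO (n k : ℕ) (γB : absoluteGaloisGroup K) (γv : absoluteGaloisGroup (v.adicCompletion K))
    (hγ : γB * resGalOfEmb (closureEmb (K := K) (v.adicCompletion K)) γv ∈ κ.kerSubgroup) (y : cycLayerCohO S κ θ' P n k 1) :
    haveI := normal_localSubgroupOfEmb_layerSubgroup κ v n
    locNK S κ θ' P v n k (cycLayerConjO S κ θ' P n k 1 γB y) = conjMap (locCoeffRep S θ' P v k).toTopRep _ γv⁻¹ 1 (locNK S κ θ' P v n k y) := by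
  haveI := normal_localSubgroupOfEmb_layerSubgroup κ v n
  haveI : (imGS P (κ.layerSubgroup n)).Normal := Subgroup.Normal.map inferInstance _ (toUnramifiedQuot_surjective K P)
  -- `π γ_B = π(u) · π(res γ_v⁻¹)` with `u = γ_B res(γ_v) ∈ ker κ ≤ U_n`
  have hu : toUnramifiedQuot K P (γB * resGalOfEmb (closureEmb (K := K) (v.adicCompletion K)) γv) ∈ imGS P (κ.layerSubgroup n) :=
    Subgroup.mem_map_of_mem _ (κ.kerSubgroup_le_layerSubgroup n hγ)
  have hfac : toUnramifiedQuot K P γB =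
      toUnramifiedQuot K P (γB * resGalOfEmb (closureEmb (K := K) (v.adicCompletion K)) γv) * locGS P v γv⁻¹ := by
    rw [locGS_apply, ← map_mul, map_inv, mul_inv_cancel_right]
  rw [locNK_apply, locNK_apply, cycLayerConjO, levelConjO_apply, hfac, conjMap_mul_apply_one, conjMap_eq_self_of_mem_one _ _ hu]
  -- restriction along `U_{n,v} → (U_n)_P` intertwines the conjugations: both composites are the map of ONE pair `(χ, h)`
  unfold conjMap
  have e1 := map_comp_apply_of (Literature.NumberTheory.EllipticCurves.subgroupConj _ (locGS P v γv⁻¹)) (locLayerHom κ P v n)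
      ((Literature.NumberTheory.EllipticCurves.subgroupConj _ (locGS P v γv⁻¹)).comp (locLayerHom κ P v n)) (fun _ ↦ rfl)
      (conjRepHom (coeffGSO S P θ' k).toTopRep _ (locGS P v γv⁻¹)) (locLayerMod S κ θ' P v n k)
      (TopRep.ofHom ⟨((coeffGSO S P θ' k).toTopRep.ρ (locGS P v γv⁻¹) : _ →L[ℤ] _), fun g ↦ ContinuousLinearMap.ext fun x ↦ by
        change (coeffGSO S P θ' k) (locGS P v γv⁻¹) ((coeffGSO S P θ' k) ((locGS P v γv⁻¹)⁻¹ * locGS P v g * locGS P v γv⁻¹) x) =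
          (coeffGSO S P θ' k) (locGS P v g) ((coeffGSO S P θ' k) (locGS P v γv⁻¹) x)
        rw [← Module.End.mul_apply, ← map_mul, ← Module.End.mul_apply, ← map_mul, ← mul_assoc, ← mul_assoc, mul_inv_cancel, one_mul]⟩) (fun _ ↦ rfl) 1 y
  have e2 := map_comp_apply_of (locLayerHom κ P v n) (Literature.NumberTheory.EllipticCurves.subgroupConj _ γv⁻¹)
    ((Literature.NumberTheory.EllipticCurves.subgroupConj _ (locGS P v γv⁻¹)).comp (locLayerHom κ P v n))
    (fun x ↦ Subtype.ext (by simp [locLayerHom_apply_coe, Literature.NumberTheory.EllipticCurves.subgroupConj_apply_coe, map_mul, map_inv]))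
    (locLayerMod S κ θ' P v n k) (conjRepHom (locCoeffRep S θ' P v k).toTopRep _ γv⁻¹)
    (TopRep.ofHom ⟨((coeffGSO S P θ' k).toTopRep.ρ (locGS P v γv⁻¹) : _ →L[ℤ] _), fun g ↦ ContinuousLinearMap.ext fun x ↦ by
        change (coeffGSO S P θ' k) (locGS P v γv⁻¹) ((coeffGSO S P θ' k) ((locGS P v γv⁻¹)⁻¹ * locGS P v g * locGS P v γv⁻¹) x) =
          (coeffGSO S P θ' k) (locGS P v g) ((coeffGSO S P θ' k) (locGS P v γv⁻¹) x)
        rw [← Module.End.mul_apply, ← map_mul, ← Module.End.mul_apply, ← map_mul, ← mul_assoc, ← mul_assoc, mul_inv_cancel, one_mul]⟩) (fun _ ↦ rfl) 1 y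
  exact e1.symm.trans e2

end Laws

end Loc

end Summit.BirchSwinnertonDyer.BirchSwinnertonDyer.Theorems.SmallImageRttD2Seq

end
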